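import Mathlib
import HarnessLib.Audit
import Summits.PneNP.PneNP.Theorems.PstarChordSystemGate
import Summits.PneNP.PneNP.Theorems.PstarChordBridgeForcing
import Summits.PneNP.PneNP.Theorems.PstarGSat

/-!
# Fresh gates on bridge data: tools (ROUND-24, memo §10.1 / §13.2, O2; targets `TerminalFiveMaxSharing` / `TerminalFiveA`)

FRONTIER range-avoidance ladder, rung F-N3, ROUND 24 (cell `pnp-ideate`, planner memo `r24/CORE-BOUND-NOTES.md` §10 (R6), §10.1 (gate-read
family), §13.2 (maximal-sharing regime: every private-touching reader is a gate `(p_e, z)` with `z` OUTSIDE the core); typed targets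
`PstarCoreBoundTargets.TerminalFiveA` / `TerminalFiveMaxSharing` (p646951); restricted-model proof complexity — nothing here bears on `P` versus `NP`).

A FRESH GATE on bridge data `B` (`PstarChordBridge`) is a monomial reader `g₀ ∈ G₁ ∪ G₂` whose AND pair is `{p, z}` with `p` a private of the
chord `e₀ ∈ N` and `z` ISOLATED: not a variable of any output of the core `J₀`, not read linearly (`z ∉ C₁ ∪ C₂`), in no other reader; every
other reader avoids the privates (the landed hypothesis `hun`, for `g ≠ g₀`) — `FreshGate`.  This file carries the bookkeeping for
`PstarFreshGate`:

* `false_of_violated` — instance form of "no free lunch": if every solution of the core violates ONE G-constraint off the core which some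
  assignment satisfies, `PstarGSat.gSat` is contradicted;
* `trim` — bridge data with the (unused) fundamental sets off `N` emptied (`wf_trim`; the model's reads `sys_trim_ρ` / `sys_trim_ρ'`);
* `flip z` — flipping the coordinate `z`; invariance of the prescribed products (`uval_flip`), of the state-free parts (`free_flip`), the read
  coefficient of a gated private `coef_gate : coef p = [p ∈ C] + [g₀ ∈ G]·x_z`;
* `FreshGate` and its consequences: the gate direction `dir B g₀ = ([g₀ ∈ G₁], [g₀ ∈ G₂]) ≠ 0`, the read vector of `p` is `c + x_z • d`
  (`readVec_p`, `readVec_p_flip`), and everything else in `sys I (trim B)` is invariant under `flip z` (`invariants`).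
-/

set_option linter.dupNamespace false -- `Summit.PneNP.PneNP.…`: summit = sub-problem name (D-0017 single-conjunct layout)

open Finset Literature.Computability.Complexity
open scoped symmDiff
open Summit.PneNP.PneNP.Theorems.PstarFibrePolys (bit bit_xor bit_injective)
open Summit.PneNP.PneNP.Theorems.PstarPDT (parity)
open Summit.PneNP.PneNP.Theorems.PstarTyped (Typed)
open Summit.PneNP.PneNP.Theorems.PstarSALevel (varSet bdry BoundaryExpanding SimpleOverlap)
open Summit.PneNP.PneNP.Theorems.PstarCentreFree (vars_mem_varSet)
open Summit.PneNP.PneNP.Theorems.PstarGapOneAll (gval)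
open Summit.PneNP.PneNP.Theorems.PstarGSat (gSat)
open Summit.PneNP.PneNP.Theorems.PstarReadSumset (V2)
open Summit.PneNP.PneNP.Theorems.PstarChordSystem (ChordSystem)
open Summit.PneNP.PneNP.Theorems.PstarChordSystemGate
open Summit.PneNP.PneNP.Theorems.PstarChordBridgeTools
open Summit.PneNP.PneNP.Theorems.PstarChordBridge

namespace Summit.PneNP.PneNP.Theorems.PstarFreshGateTools

variable {n m : ℕ}

/-! ## No free lunch, instance form -/

/-- **A G-constraint off the core violated by every solution of the core, yet satisfiable, is impossible** (`PstarGSat.gSat` twice). -/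
theorem false_of_violated (I : LocalMap 4 n m) (hI : I.IsPure xorAndPred) (hT : Typed I) (hS : SimpleOverlap I) {r : ℕ}
    (hB : BoundaryExpanding r I) (y : Fin m → Bool) {J₀ : Finset (Fin m)} (hne : J₀.Nonempty) (hJr : J₀.card ≤ r)
    {C : Finset (Fin n)} {G : Finset (Fin m)} {b : Bool} (hG : Disjoint J₀ G)
    (hviol : ∀ z : Fin n → Bool, (∀ j ∈ J₀, I.eval z j = y j) → gval I C G z ≠ b) (hsat : ∃ z, gval I C G z = b) : False := by
  classical
  have hconst : ∀ z z', gval I C G z = gval I C G z' := by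
    intro z z'
    by_contra h
    obtain ⟨z₀, hz₀, hb⟩ := gSat n m r I hI hT hB hS y J₀ G C b hJr hG ⟨z, z', h⟩
    exact hviol z₀ hz₀ hb
  obtain ⟨z₁, hz₁⟩ := hsat
  obtain ⟨j₀, hj₀⟩ := hne
  have hnc : ∃ z z' : Fin n → Bool, gval I {I.vars j₀ 0} ∅ z ≠ gval I {I.vars j₀ 0} ∅ z' := by
    refine ⟨fun _ => true, fun _ => false, ?_⟩
    simp [PstarGapOneAll.gval, parity]
  obtain ⟨z, hz, -⟩ := gSat n m r I hI hT hB hS y J₀ ∅ {I.vars j₀ 0} true hJr (disjoint_empty_right _) hnc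
  exact hviol z hz ((hconst z z₁).trans hz₁)

/-! ## Trimmed bridge data -/

/-- Bridge data with the (unused) fundamental sets off `N` emptied. -/
def trim (B : BridgeData n m) : BridgeData n m := { B with D := fun e => if e ∈ B.N then B.D e else ∅ }

/-- On `N` the fundamental sets are unchanged. -/
theorem trim_D_of_mem {B : BridgeData n m} {e : Fin m} (he : e ∈ B.N) : (trim B).D e = B.D e := if_pos he

/-- Off `N` the fundamental sets are empty. -/
theorem trim_D_of_not_mem {B : BridgeData n m} {e : Fin m} (he : e ∉ B.N) : (trim B).D e = ∅ := if_neg he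

/-- Trimming preserves well-formedness. -/
theorem wf_trim (I : LocalMap 4 n m) {B : BridgeData n m} (hW : B.WF I) : (trim B).WF I where
  hN := hW.hN
  hchord := hW.hchord
  hD e he := by rw [trim_D_of_mem (B := B) he]; exact hW.hD e he
  hDeven e he w := by rw [trim_D_of_mem (B := B) he]; exact hW.hDeven e he w
  hT₁ := hW.hT₁
  hT₂ := hW.hT₂
  hjoin₁ := hW.hjoin₁
  hjoin₂ := hW.hjoin₂
  hcross₁ := hW.hcross₁
  hcross₂ := hW.hcross₂

/-- Reads of a chord in the model of the trimmed data. -/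
theorem sys_trim_ρ (I : LocalMap 4 n m) (B : BridgeData n m) {e : Fin m} (he : e ∈ B.N) (x : Fin n → ZMod 2) :
    (sys I (trim B)).ρ e x = (coef I B.C₁ B.G₁ (I.vars e 2) x, coef I B.C₂ B.G₂ (I.vars e 2) x) := sys_ρ I (trim B) he x

/-- Reads of a chord in the model of the trimmed data. -/
theorem sys_trim_ρ' (I : LocalMap 4 n m) (B : BridgeData n m) {e : Fin m} (he : e ∈ B.N) (x : Fin n → ZMod 2) :
    (sys I (trim B)).ρ' e x = (coef I B.C₁ B.G₁ (I.vars e 3) x, coef I B.C₂ B.G₂ (I.vars e 3) x) := sys_ρ' I (trim B) he x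

/-- Off `N` the model of the trimmed data reads nothing. -/
theorem sys_trim_ρ_of_not_mem (I : LocalMap 4 n m) (B : BridgeData n m) {e : Fin m} (he : e ∉ B.N) (x : Fin n → ZMod 2) :
    (sys I (trim B)).ρ e x = 0 ∧ (sys I (trim B)).ρ' e x = 0 := sys_ρ_of_not_mem I (trim B) he x

/-! ## The gate symmetry of a fresh gate -/

/-- Flipping the coordinate `z`. -/
def flip (z : Fin n) (x : Fin n → ZMod 2) : Fin n → ZMod 2 := Function.update x z (x z + 1)

/-- `flip` does not move the other coordinates. -/
theorem flip_of_ne {z v : Fin n} (h : v ≠ z) (x : Fin n → ZMod 2) : flip z x v = x v := by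
  unfold flip; rw [Function.update_of_ne h]

/-- `flip` flips `z`. -/
@[simp] theorem flip_self (z : Fin n) (x : Fin n → ZMod 2) : flip z x z = x z + 1 := by
  unfold flip; rw [Function.update_self]

/-- `flip z` does not move the variables of an output avoiding `z`. -/
theorem flip_vars {I : LocalMap 4 n m} {z : Fin n} {j : Fin m} (hz : z ∉ varSet I j) (s : Fin 4) (x : Fin n → ZMod 2) :
    flip z x (I.vars j s) = x (I.vars j s) :=
  flip_of_ne (z := z) (v := I.vars j s) (fun h => hz (h ▸ vars_mem_varSet I j s)) x

/-- The prescribed product does not see a coordinate outside the outputs of its fundamental set. -/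
theorem uval_flip (I : LocalMap 4 n m) (y : Fin m → Bool) {D : Finset (Fin m)} {z : Fin n} (hz : ∀ j ∈ D, z ∉ varSet I j) (e : Fin m)
    (x : Fin n → ZMod 2) : uval I y D e (flip z x) = uval I y D e x := by
  unfold uval
  congr 1
  refine sum_congr rfl fun j hj => ?_
  rw [flip_vars (hz j hj) 2, flip_vars (hz j hj) 3]

/-- The state-free part does not see an isolated coordinate. -/
theorem free_flip (I : LocalMap 4 n m) (y : Fin m → Bool) {F N T : Finset (Fin m)} (hTF : T ⊆ F) {C : Finset (Fin n)} {G : Finset (Fin m)}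
    {z : Fin n} (hzF : ∀ j ∈ F, z ∉ varSet I j) (hzC : z ∉ C)
    (hzG : ∀ g ∈ G, ¬ (I.vars g 2 ∈ privs I N ∨ I.vars g 3 ∈ privs I N) → I.vars g 2 ≠ z ∧ I.vars g 3 ≠ z) (x : Fin n → ZMod 2) :
    free I y F N T C G (flip z x) = free I y F N T C G x := by
  unfold free
  congr 1
  · congr 1
    · exact sum_congr rfl fun v hv => flip_of_ne (v := v) (z := z) (fun h => hzC (h ▸ (mem_filter.1 hv).1)) x
    · refine sum_congr rfl fun j hj => ?_
      rw [flip_vars (hzF j (hTF hj)) 2, flip_vars (hzF j (hTF hj)) 3]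
  · refine sum_congr rfl fun g hg => ?_
    obtain ⟨hg, hg'⟩ := mem_filter.1 hg
    rw [flip_of_ne (hzG g hg hg').1, flip_of_ne (hzG g hg hg').2]

/-- The read coefficient of a private touched by no reader other than possibly `g₀ = (p, z)`: `[p ∈ C] + [g₀ ∈ G]·x_z`. -/
theorem coef_gate (I : LocalMap 4 n m) {C : Finset (Fin n)} {G : Finset (Fin m)} {p z : Fin n} {g₀ : Fin m} (hpz : p ≠ z)
    (hg₀ : (I.vars g₀ 2 = p ∧ I.vars g₀ 3 = z) ∨ (I.vars g₀ 2 = z ∧ I.vars g₀ 3 = p))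
    (h : ∀ g ∈ G, g ≠ g₀ → I.vars g 2 ≠ p ∧ I.vars g 3 ≠ p) (x : Fin n → ZMod 2) :
    coef I C G p x = (if p ∈ C then 1 else 0) + (if g₀ ∈ G then x z else 0) := by
  classical
  unfold coef
  congr 1
  by_cases hG : g₀ ∈ G
  · rw [if_pos hG, ← add_sum_erase G _ hG, sum_eq_zero fun g hg => by
      rw [if_neg (h g (mem_of_mem_erase hg) (ne_of_mem_erase hg)).1, if_neg (h g (mem_of_mem_erase hg) (ne_of_mem_erase hg)).2, add_zero],
      add_zero]
    rcases hg₀ with ⟨h2, h3⟩ | ⟨h2, h3⟩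
    · rw [if_pos h2, h3, if_neg (Ne.symm hpz), add_zero]
    · rw [if_neg (by rw [h2]; exact Ne.symm hpz), if_pos h3, h2, zero_add]
  · rw [if_neg hG]
    exact sum_eq_zero fun g hg => by
      rw [if_neg (h g hg (fun h' => hG (h' ▸ hg))).1, if_neg (h g hg (fun h' => hG (h' ▸ hg))).2, add_zero]

/-- **Fresh-gate data** on bridge data `B`: the gated chord `e₀ ∈ N`, its gated private `p = vars e₀ s₀`, the reader `g₀` with AND pair
`{p, z}`, the isolation of `z`, and: every other reader avoids the privates. -/
structure FreshGate (I : LocalMap 4 n m) (B : BridgeData n m) (e₀ g₀ : Fin m) (s₀ : Fin 4) (z : Fin n) : Prop where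
  /-- the gated chord -/
  he₀ : e₀ ∈ B.N
  /-- the gated slot is an AND slot -/
  hs₀ : 2 ≤ s₀.val
  /-- the reader is a monomial of one of the constraints -/
  hg₀ : g₀ ∈ B.G₁ ∪ B.G₂
  /-- its AND pair is `{p, z}` -/
  hpair : (I.vars g₀ 2 = I.vars e₀ s₀ ∧ I.vars g₀ 3 = z) ∨ (I.vars g₀ 2 = z ∧ I.vars g₀ 3 = I.vars e₀ s₀)
  /-- `z` is not a variable of the core -/
  hzJ : ∀ j ∈ B.J₀, z ∉ varSet I j
  /-- `z` is not read linearly -/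
  hzC : z ∉ B.C₁ ∧ z ∉ B.C₂
  /-- `z` is in no other reader -/
  hzG : ∀ g ∈ B.G₁ ∪ B.G₂, g ≠ g₀ → I.vars g 2 ≠ z ∧ I.vars g 3 ≠ z
  /-- every other reader avoids the privates -/
  hun : ∀ g ∈ B.G₁ ∪ B.G₂, g ≠ g₀ → ∀ v ∈ privs I B.N, I.vars g 2 ≠ v ∧ I.vars g 3 ≠ v

/-- The gate direction `d = ([g₀ ∈ G₁], [g₀ ∈ G₂])`. -/
def dir (B : BridgeData n m) (g₀ : Fin m) : V2 := (if g₀ ∈ B.G₁ then 1 else 0, if g₀ ∈ B.G₂ then 1 else 0)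

namespace FreshGate

variable {I : LocalMap 4 n m} {B : BridgeData n m} {e₀ g₀ : Fin m} {s₀ : Fin 4} {z : Fin n}

/-- The gate direction is non-zero. -/
theorem dir_ne_zero (h : FreshGate I B e₀ g₀ s₀ z) : dir B g₀ ≠ 0 := by
  intro h0
  have h1 : (dir B g₀).1 = 0 := by rw [h0]; rfl
  have h2 : (dir B g₀).2 = 0 := by rw [h0]; rfl
  unfold dir at h1 h2
  rcases mem_union.1 h.hg₀ with hg | hg
  · simp only [if_pos hg] at h1; exact one_ne_zero h1
  · simp only [if_pos hg] at h2; exact one_ne_zero h2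

/-- The gated private is a private. -/
theorem p_mem_privs (h : FreshGate I B e₀ g₀ s₀ z) : I.vars e₀ s₀ ∈ privs I B.N := vars_mem_privs I h.he₀ h.hs₀

/-- `z` is not a private. -/
theorem z_not_mem_privs (hW : B.WF I) (h : FreshGate I B e₀ g₀ s₀ z) : z ∉ privs I B.N := by
  rw [mem_privs]
  rintro ⟨e, he, hz | hz⟩
  · exact h.hzJ e (hW.hN he) (hz ▸ vars_mem_varSet I e 2)
  · exact h.hzJ e (hW.hN he) (hz ▸ vars_mem_varSet I e 3)

/-- `p ≠ z`. -/
theorem p_ne_z (hW : B.WF I) (h : FreshGate I B e₀ g₀ s₀ z) : I.vars e₀ s₀ ≠ z :=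
  fun hz => h.hzJ e₀ (hW.hN h.he₀) (hz ▸ vars_mem_varSet I e₀ s₀)

/-- No reader touches a private other than the gated one. -/
theorem unread_of_ne (hW : B.WF I) (h : FreshGate I B e₀ g₀ s₀ z) {v : Fin n} (hv : v ∈ privs I B.N) (hvp : v ≠ I.vars e₀ s₀) :
    (∀ g ∈ B.G₁, I.vars g 2 ≠ v ∧ I.vars g 3 ≠ v) ∧ ∀ g ∈ B.G₂, I.vars g 2 ≠ v ∧ I.vars g 3 ≠ v := by
  have key : ∀ g ∈ B.G₁ ∪ B.G₂, I.vars g 2 ≠ v ∧ I.vars g 3 ≠ v := by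
    intro g hg
    by_cases hgg : g = g₀
    · subst hgg
      have hzv : z ≠ v := fun hzv => h.z_not_mem_privs hW (hzv ▸ hv)
      rcases h.hpair with ⟨h2, h3⟩ | ⟨h2, h3⟩
      · exact ⟨by rw [h2]; exact hvp.symm, by rw [h3]; exact hzv⟩
      · exact ⟨by rw [h2]; exact hzv, by rw [h3]; exact hvp.symm⟩
    · exact h.hun g hg hgg v hv
  exact ⟨fun g hg => key g (mem_union_left _ hg), fun g hg => key g (mem_union_right _ hg)⟩

/-- The read vector of the gated private in the model: `([p ∈ C₁], [p ∈ C₂]) + x_z • d`. -/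
theorem readVec_p (hW : B.WF I) (h : FreshGate I B e₀ g₀ s₀ z) (x : Fin n → ZMod 2) :
    ((coef I B.C₁ B.G₁ (I.vars e₀ s₀) x, coef I B.C₂ B.G₂ (I.vars e₀ s₀) x) : V2) =
      ((if I.vars e₀ s₀ ∈ B.C₁ then 1 else 0, if I.vars e₀ s₀ ∈ B.C₂ then 1 else 0) : V2) + x z • dir B g₀ := by
  rw [coef_gate I (h.p_ne_z hW) h.hpair (fun g hg hne => h.hun g (mem_union_left _ hg) hne _ h.p_mem_privs) x,
    coef_gate I (h.p_ne_z hW) h.hpair (fun g hg hne => h.hun g (mem_union_right _ hg) hne _ h.p_mem_privs) x]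
  unfold dir
  refine Prod.ext ?_ ?_
  · simp only [Prod.fst_add, Prod.smul_fst, smul_eq_mul]
    by_cases hg : g₀ ∈ B.G₁
    · rw [if_pos hg, if_pos hg, mul_one]
    · rw [if_neg hg, if_neg hg, mul_zero]
  · simp only [Prod.snd_add, Prod.smul_snd, smul_eq_mul]
    by_cases hg : g₀ ∈ B.G₂
    · rw [if_pos hg, if_pos hg, mul_one]
    · rw [if_neg hg, if_neg hg, mul_zero]

/-- The read vector of the gated private shifts by `d` under `flip z`. -/
theorem readVec_p_flip (hW : B.WF I) (h : FreshGate I B e₀ g₀ s₀ z) (x : Fin n → ZMod 2) :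
    ((coef I B.C₁ B.G₁ (I.vars e₀ s₀) (flip z x), coef I B.C₂ B.G₂ (I.vars e₀ s₀) (flip z x)) : V2) =
      ((coef I B.C₁ B.G₁ (I.vars e₀ s₀) x, coef I B.C₂ B.G₂ (I.vars e₀ s₀) x) : V2) + dir B g₀ := by
  rw [h.readVec_p hW, h.readVec_p hW, flip_self, add_smul, one_smul, add_assoc]

/-- The state-free parts, the prescribed products (trimmed data) and the reads of the other privates are invariant under `flip z`. -/
theorem invariants (hW : B.WF I) (h : FreshGate I B e₀ g₀ s₀ z) (x : Fin n → ZMod 2) :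
    (sys I (trim B)).F (flip z x) = (sys I (trim B)).F x ∧ (∀ e, (sys I (trim B)).u e (flip z x) = (sys I (trim B)).u e x) ∧
    ∀ v ∈ privs I B.N, v ≠ I.vars e₀ s₀ →
      coef I B.C₁ B.G₁ v (flip z x) = coef I B.C₁ B.G₁ v x ∧ coef I B.C₂ B.G₂ v (flip z x) = coef I B.C₂ B.G₂ v x := by
  have hzF : ∀ j ∈ B.J₀ \ B.N, z ∉ varSet I j := fun j hj => h.hzJ j (mem_sdiff.1 hj).1
  have hzG : ∀ g ∈ B.G₁ ∪ B.G₂, ¬ (I.vars g 2 ∈ privs I B.N ∨ I.vars g 3 ∈ privs I B.N) → I.vars g 2 ≠ z ∧ I.vars g 3 ≠ z := by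
    intro g hg hnp
    refine h.hzG g hg fun hgg => hnp ?_
    subst hgg
    rcases h.hpair with ⟨h2, -⟩ | ⟨-, h3⟩
    · exact Or.inl (h2 ▸ h.p_mem_privs)
    · exact Or.inr (h3 ▸ h.p_mem_privs)
  refine ⟨?_, fun e => ?_, fun v hv hvp => ?_⟩
  · show ((free I B.y (B.J₀ \ B.N) B.N B.T₁ B.C₁ B.G₁ (flip z x), free I B.y (B.J₀ \ B.N) B.N B.T₂ B.C₂ B.G₂ (flip z x)) : V2) =
      (free I B.y (B.J₀ \ B.N) B.N B.T₁ B.C₁ B.G₁ x, free I B.y (B.J₀ \ B.N) B.N B.T₂ B.C₂ B.G₂ x)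
    rw [free_flip I B.y hW.hT₁ hzF h.hzC.1 (fun g hg => hzG g (mem_union_left _ hg)),
      free_flip I B.y hW.hT₂ hzF h.hzC.2 (fun g hg => hzG g (mem_union_right _ hg))]
  · rw [sys_u, sys_u]
    by_cases he : e ∈ B.N
    · rw [trim_D_of_mem he]
      exact uval_flip I B.y (fun j hj => hzF j (hW.hD e he hj)) e x
    · rw [trim_D_of_not_mem he]
      exact uval_flip I B.y (fun j hj => absurd hj (notMem_empty j)) e x
  · have hun := h.unread_of_ne hW hv hvp
    rw [PstarChordBridgeForcing.coef_of_unread I hun.1, PstarChordBridgeForcing.coef_of_unread I hun.1,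
      PstarChordBridgeForcing.coef_of_unread I hun.2, PstarChordBridgeForcing.coef_of_unread I hun.2]
    exact ⟨rfl, rfl⟩

end FreshGate

end Summit.PneNP.PneNP.Theorems.PstarFreshGateTools
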